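import Literature.NumberTheory.IwasawaTheory.WeakLeopoldtCyclotomicProof
import HarnessLib

/-!
# Weak Leopoldt above `K′(μ_{p^∞})` WITHOUT the parity hypothesis: `p ≠ 2 ∨ K totally complex`
# (crux `SplitBadTwoRankOneOfFacts`, stmt-BirchSwinnertonDyer-20368; road (γ) at `p = 2`, input hH2₂)

Cell `bsd-print-cf2`, width seat `bsd-line-cf2-p1-w2` gen 12, lane S3n / S3n′
(`stub_pseudoNullFinite_two`, skeleton v10.6 of crux 20368): the LEO input «`H²` above `K̃_∞`» of the
`p = 2` twin of the bsd-eis road (γ) (`GreenbergFullAtSelmer.noPseudoNull_of_facts_of_weakLeopoldt_of_bridge_ofTate`,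
-w5 g4's parity-free cut `…PrintCf2.NoPseudoNullCut`).

The tree PROVES weak Leopoldt for the cyclotomic tower at ODD `p`
(`Literature.NumberTheory.IwasawaTheory.stagesDie`, `weakLeopoldt_H2_subsingleton_cyclotomic_of_isOpen_holds`,
`WeakLeopoldtCyclotomicProof.lean`).  In that proof the hypothesis `p ≠ 2` is used at exactly ONE
place: the Brauer killing `GaloisCohomology.exists_forall_resSub_mu_primePow_eq_zero_of_le_layerSubgroup`,
whose hypothesis is in fact the DISJUNCTION `p ≠ 2 ∨ IsTotallyComplex K` (real places carry
`H²(ℝ, μ₂) ≠ 0` at `p = 2`; a totally complex field has none), but which the odd-`p` files call with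
`Or.inl hp2`.  This file re-runs the three affected theorems with the disjunction — proofs copied
token for token from `WeakLeopoldtCyclotomicStageKilling.lean` §1–§2 and `WeakLeopoldtCyclotomicProof.lean`
§2 (seat `bsd-line-x1-p1-w2` gen 7/8 of cell `bsd-eis`), `Or.inl hp2` replaced by the disjunction —
and records the consequence that needs NO descent:

* §1 `exists_forall_resSub_eq_zero_of_isOpen_of_fixes'`, `exists_stage_resSub_inflation_eq_zero'`,
  **`stagesDie'`** — `(hk : p ≠ 2 ∨ IsTotallyComplex K)` in place of `p ≠ 2`.
* §2 **`subsingleton_H2_above_muInfty`** — for a number field `K` and a prime `p` with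
  `p ≠ 2 ∨ IsTotallyComplex K`, a finite `S ⊇ {v ∣ p}`, an open `U₀ ≥ N_S` (`K′ := K̄^{U₀} ⊆ K_Σ`) and a
  discrete `D ≃+ ℚ_p/ℤ_p` with the trivial action (inert coefficient ring `R`):
  `H²(Gal(K_Σ/K′(μ_{p^∞})), D) = 0`, i.e. the continuous `H²` of
  `galoisGroupAbove S (U₀ ⊓ ⨅ₖ ker χ̄_{p^k})` vanishes — the tree's limit step
  `subsingleton_H2_above_muInfty_of_stagesDie` (parity-free) fed with `stagesDie'`.

At odd `p` this is one prime-to-`p` descent away from (T4); at `p = 2` the descent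
`K′(μ_{2^∞}) → K′K^{cyc}_∞` has index `≤ 2` and is NOT performed here (the consumer at `p = 2` adjoins
`i` to `K′` instead: sequel `…WeakLeopoldtAboveTowerMuInfty`).  Theorems only; no definition, no named
fact, no `sorry`, no instance.  HONEST FRAMING: a theorem of Iwasawa 1973 / NSW (10.3.25) in the
tree's stage currency; closes nothing by itself (`--supports`); no summit statement / BSD / the crux
is proved here.

References: [NeukirchSchmidtWingberg2008] (10.3.25) (proof), (10.3.22), (8.3.11) (ii); [Iwasawa1973] §2;
[SerreGaloisCohomology1997] II §4.4 Prop. 13, I §2.2 Prop. 8, I §2.4 Prop. 9; [Washington1997] §13.1.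
-/

noncomputable section

open scoped Classical
open NumberField IsDedekindDomain Field
open Literature.NumberTheory.GaloisRepresentations
open Literature.NumberTheory.GaloisRepresentations.DiscreteGaloisModule
open Literature.NumberTheory.EllipticCurves (ZpExtension)
open Literature.NumberTheory.IwasawaTheory Literature.NumberTheory.IwasawaTheory.Greenberg2006
open _root_.TopRep _root_.ContRepresentation _root_.ContinuousCohomology

-- `Summit.BirchSwinnertonDyer.BirchSwinnertonDyer.…`: the summit and its single sub-problem share a name (D-0017 layout).
set_option linter.dupNamespace false

namespace Summit.BirchSwinnertonDyer.BirchSwinnertonDyer.Theorems.PrintCf2.WeakLeopoldtTwo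

variable {K : Type} [Field K] [NumberField K] (p : ℕ) [hp : Fact p.Prime]
  (S : Set (HeightOneSpectrum (𝓞 K)))

/-! ### §1. The stage-killing statement with the disjunction `p ≠ 2 ∨ IsTotallyComplex K` -/

/-- **Brauer killing on a cyclotomic layer, for an OPEN subgroup `H ≤ Γ_K` fixing `μ_p`** — the tree's
`exists_forall_resSub_eq_zero_of_isOpen_of_fixes` with `p ≠ 2` weakened to `p ≠ 2 ∨ IsTotallyComplex K`
(the actual hypothesis of `GaloisCohomology.exists_forall_resSub_mu_primePow_eq_zero_of_le_layerSubgroup`).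
-- adapted from Literature/NumberTheory/IwasawaTheory/WeakLeopoldtCyclotomicStageKilling.lean §1
[cite: SerreGaloisCohomology1997, II §4.4 Prop. 13 (with Lemme 1)] [cite: NeukirchSchmidtWingberg2008, (10.3.25) (proof)] -/
theorem exists_forall_resSub_eq_zero_of_isOpen_of_fixes' (hk : p ≠ 2 ∨ IsTotallyComplex K)
    {κ : ZpExtension K p}
    (hκ : κ.IsCyclotomic) (m : ℕ) (H : Subgroup (absoluteGaloisGroup K))
    (hH : IsOpen (H : Set (absoluteGaloisGroup K)))
    (hfix : ∀ σ ∈ H, ∀ ζ : rootsOfUnity p (AlgebraicClosure K),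
      σ • (ζ : (AlgebraicClosure K)ˣ) = ζ)
    (y : continuousCohomology 2 ((mu K (p ^ m)).restrict (subgroupIncl H)).toTopRep) :
    ∃ M : ℕ, ∀ (T : Subgroup (absoluteGaloisGroup K)) (hTH : T ≤ H),
      IsClosed (T : Set (absoluteGaloisGroup K)) → T ≤ κ.layerSubgroup M →
        resSub (mu K (p ^ m)) hTH 2 y = 0 := by
  obtain ⟨E, hEfin, hE⟩ := exists_galFixing_eq_of_isOpen H hH
  subst hE
  haveI := hEfin
  obtain ⟨M, hM⟩ := Literature.NumberTheory.GaloisCohomology.exists_forall_resSub_mu_primePow_eq_zero_of_le_layerSubgroup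
    K hk hκ m E hfix y
  exact ⟨M, fun T hTH hT hle ↦ by
    haveI : IsClosed (T : Set (absoluteGaloisGroup K)) := hT
    exact hM T hTH hle⟩

/-- **The Brauer part of a stage class dies on a deeper stage** — the tree's
`exists_stage_resSub_inflation_eq_zero` with `p ≠ 2` weakened to `p ≠ 2 ∨ IsTotallyComplex K`;
statement otherwise VERBATIM (stage `H_k = U₀ ⊓ ker χ̄_{p^k}`, `1 ≤ k`, a descended continuous action
`ρG` on `μ_{p^a}`, a continuous `2`-cocycle `f`; conclusion: a deeper level `k ≥ k` and an inflation
map `infl` computed on cocycles with `res_{H_{k}} (infl [f]) = 0`).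
-- adapted from Literature/NumberTheory/IwasawaTheory/WeakLeopoldtCyclotomicStageKilling.lean §2
[cite: NeukirchSchmidtWingberg2008, (10.3.25) (proof)] [cite: SerreGaloisCohomology1997, II §4.4 Prop. 13, I §2.4]
[cite: Washington1997, §13.1] -/
theorem exists_stage_resSub_inflation_eq_zero' (hk2 : p ≠ 2 ∨ IsTotallyComplex K)
    (U₀ : Subgroup (absoluteGaloisGroup K)) (hU₀ : IsOpen (U₀ : Set (absoluteGaloisGroup K)))
    {k : ℕ} (hk : 1 ≤ k) {a : ℕ}
    (ρG : ContinuousRep (galoisGroupAbove S (U₀ ⊓ (modNCyclotomicCharacter K (p ^ k)).ker)) ℤ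
      (MuCarrier K (p ^ a)))
    (hρG : ∀ (σ : (U₀ ⊓ (modNCyclotomicCharacter K (p ^ k)).ker : Subgroup (absoluteGaloisGroup K)))
      (v : MuCarrier K (p ^ a)),
      ρG ⟨toUnramifiedQuot K S (σ : absoluteGaloisGroup K), coe_mem_galoisGroupAbove S _ σ⟩ v =
        mu K (p ^ a) (σ : absoluteGaloisGroup K) v)
    (f : contTwoCocycles ρG.toTopRep)
    (hH : IsClosed ((U₀ ⊓ (modNCyclotomicCharacter K (p ^ k)).ker : Subgroup (absoluteGaloisGroup K)) :
      Set (absoluteGaloisGroup K))) :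
    haveI : CompactSpace (galoisGroupAbove S (U₀ ⊓ (modNCyclotomicCharacter K (p ^ k)).ker)) :=
      compactSpace_galoisGroupAbove S _ hH
    ∃ (k' : ℕ) (hkk' : k ≤ k')
      (_ : IsClosed ((U₀ ⊓ (modNCyclotomicCharacter K (p ^ k')).ker : Subgroup (absoluteGaloisGroup K)) :
        Set (absoluteGaloisGroup K)))
      (infl : (continuousCohomology 2 ρG.toTopRep : Type) →+
        (continuousCohomology 2 ((mu K (p ^ a)).restrict
          (subgroupIncl (U₀ ⊓ (modNCyclotomicCharacter K (p ^ k)).ker))).toTopRep : Type)),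
      (∀ (f : contTwoCocycles ρG.toTopRep)
          (F : contTwoCocycles ((mu K (p ^ a)).restrict
            (subgroupIncl (U₀ ⊓ (modNCyclotomicCharacter K (p ^ k)).ker))).toTopRep),
        (∀ σ τ : (U₀ ⊓ (modNCyclotomicCharacter K (p ^ k)).ker : Subgroup (absoluteGaloisGroup K)),
          F.1 (σ, τ) =
            f.1 (⟨toUnramifiedQuot K S (σ : absoluteGaloisGroup K), coe_mem_galoisGroupAbove S _ σ⟩,
              ⟨toUnramifiedQuot K S (τ : absoluteGaloisGroup K), coe_mem_galoisGroupAbove S _ τ⟩)) →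
        infl (twoCocycleClass _ f) = twoCocycleClass _ F) ∧
      resSub (mu K (p ^ a))
          (inf_le_inf_left U₀ (ker_modNCyclotomicCharacter_antitone p hkk')) 2
          (infl (twoCocycleClass _ f)) = 0 := by
  -- topology of the open subgroup `H_k = U₀ ⊓ F_k`
  haveI : CompactSpace (galoisGroupAbove S (U₀ ⊓ (modNCyclotomicCharacter K (p ^ k)).ker)) :=
    compactSpace_galoisGroupAbove S _ hH
  have hHo : IsOpen ((U₀ ⊓ (modNCyclotomicCharacter K (p ^ k)).ker : Subgroup (absoluteGaloisGroup K)) :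
      Set (absoluteGaloisGroup K)) :=
    hU₀.inter (isOpen_ker_modNCyclotomicCharacter p k)
  -- the inflation map computed on cocycles
  obtain ⟨infl, hinfl⟩ := exists_inflation₂ S _ hH ρG hρG
  -- the cyclotomic `ℤ_p`-extension and the Brauer-killing layer bound for `infl [f]`
  obtain ⟨κ, hκ⟩ := Literature.NumberTheory.EllipticCurves.exists_cyclotomicZpExtension_holds K p
  have hfix : ∀ σ ∈ U₀ ⊓ (modNCyclotomicCharacter K (p ^ k)).ker,
      ∀ ζ : rootsOfUnity p (AlgebraicClosure K), σ • (ζ : (AlgebraicClosure K)ˣ) = ζ :=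
    fun σ hσ ζ ↦ smul_rootsOfUnity_eq_of_mem_inf_ker p U₀ hk hσ ζ
  obtain ⟨M, hM⟩ := exists_forall_resSub_eq_zero_of_isOpen_of_fixes' p hk2 hκ a _ hHo hfix
    (infl (twoCocycleClass _ f))
  -- the levels eventually enter the layer
  obtain ⟨k₀, hk₀⟩ := exists_forall_inf_ker_modNCyclotomicCharacter_le_layerSubgroup p hκ U₀ M
  have hT : IsClosed ((U₀ ⊓ (modNCyclotomicCharacter K (p ^ max k k₀)).ker :
      Subgroup (absoluteGaloisGroup K)) : Set (absoluteGaloisGroup K)) :=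
    (Subgroup.isClosed_of_isOpen U₀ hU₀).inter
      (Subgroup.isClosed_of_isOpen _ (isOpen_ker_modNCyclotomicCharacter p (max k k₀)))
  refine ⟨max k k₀, le_max_left k k₀, hT, infl, hinfl, ?_⟩
  exact hM _ _ hT (hk₀ _ (le_max_right k k₀))

set_option maxHeartbeats 400000 in
/-- **«stagesDie» with the disjunction `p ≠ 2 ∨ IsTotallyComplex K`** — the finite-level killing
statement of `WeakLeopoldtCyclotomicLevels.lean` (hypothesis of `subsingleton_H2_above_muInfty_of_stagesDie`,
VERBATIM): a continuous `2`-cocycle of the stage `Gal(K_S/K′(μ_{p^k}))` with values in a finite `A ≤ D`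
killed by `p^a`, `a ≤ k`, becomes on a deeper stage, read in `D`, a continuous coboundary.  Proof = the
tree's `stagesDie` (NSW (10.3.25): coefficients inside `μ_{p^a}`, Brauer killing on a deeper stage,
the `S`-ideal-class part by radical descent at the open stage, read back in `D`) with §1's
`exists_stage_resSub_inflation_eq_zero'` in place of the odd-`p` one.
-- adapted from Literature/NumberTheory/IwasawaTheory/WeakLeopoldtCyclotomicProof.lean §2 (token for token)
[cite: NeukirchSchmidtWingberg2008, (10.3.25) (proof), (8.3.11) (ii)] [cite: Iwasawa1973, §2]
[cite: SerreGaloisCohomology1997, II §4.4 Prop. 13] -/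
theorem stagesDie' (hk2 : p ≠ 2 ∨ IsTotallyComplex K)
    (hS : ∀ v : HeightOneSpectrum (𝓞 K), ((p : ℕ) : 𝓞 K) ∈ v.asIdeal → v ∈ S)
    (U₀ : Subgroup (absoluteGaloisGroup K)) (hU₀ : IsOpen (U₀ : Set (absoluteGaloisGroup K)))
    (hN : ramificationSubgroup K S ≤ U₀)
    (D : Type) [AddCommGroup D] [TopologicalSpace D] [DiscreteTopology D]
    (hD : Nonempty (D ≃+ ℚ_[p] ⧸ (PadicInt.subring p).toAddSubgroup))
    (k a : ℕ) (hak : a ≤ k) (A : AddSubgroup D) [Finite A] (hA : ∀ x ∈ A, p ^ a • x = 0)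
    (c : contTwoCocycles (((ContinuousRep.trivial (GaloisGroupUnramifiedOutside K S) ℤ A).restrict
      (subgroupIncl (galoisGroupAbove S (U₀ ⊓ (modNCyclotomicCharacter K (p ^ k)).ker)))).toTopRep)) :
    ∃ (k' : ℕ) (hkk' : k ≤ k')
      (b : C(galoisGroupAbove S (U₀ ⊓ (modNCyclotomicCharacter K (p ^ k')).ker), D)),
      ∀ σ τ : galoisGroupAbove S (U₀ ⊓ (modNCyclotomicCharacter K (p ^ k')).ker),
        ((c.1 (Subgroup.inclusion
            (galoisGroupAbove_inf_ker_modNCyclotomicCharacter_antitone p S U₀ hkk') σ,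
          Subgroup.inclusion
            (galoisGroupAbove_inf_ker_modNCyclotomicCharacter_antitone p S U₀ hkk') τ) : A) : D) =
          b τ - b (σ * τ) + b σ := by
  -- the degenerate level `k = 0`: `a = 0`, `A = 0`, `c = 0`
  rcases Nat.eq_zero_or_pos k with hk0 | hkpos
  · subst hk0
    have ha0 : a = 0 := Nat.le_zero.mp hak
    have hA0 : ∀ x : A, (x : D) = 0 := fun x ↦ by
      have h := hA x x.2
      rwa [ha0, pow_zero, one_smul] at h
    exact ⟨0, le_rfl, 0, fun σ τ ↦ by simp only [ContinuousMap.zero_apply, sub_zero, add_zero, hA0]⟩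
  have hk : 1 ≤ k := hkpos
  -- notation: the level subgroups and the stage `H = U₀ ⊓ F_k`
  have hHo : IsOpen ((U₀ ⊓ (modNCyclotomicCharacter K (p ^ k)).ker : Subgroup (absoluteGaloisGroup K)) :
      Set (absoluteGaloisGroup K)) := hU₀.inter (isOpen_ker_modNCyclotomicCharacter p k)
  have hH : IsClosed ((U₀ ⊓ (modNCyclotomicCharacter K (p ^ k)).ker : Subgroup (absoluteGaloisGroup K)) :
      Set (absoluteGaloisGroup K)) := Subgroup.isClosed_of_isOpen _ hHo
  haveI : CompactSpace (galoisGroupAbove S (U₀ ⊓ (modNCyclotomicCharacter K (p ^ k)).ker)) :=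
    compactSpace_galoisGroupAbove S _ hH
  -- (i) coefficients: `A ↪ μ_{p^a}(K̄)`, with the ways back `μ_{p^{a+t}}(K̄) → D`
  obtain ⟨e, -, hg⟩ := exists_muCarrier_embedding_extension K p hD A hA
  -- (ii) the `μ_{p^a}`-valued stage cocycle, for the TRIVIAL (= descended, §1) action
  let ρG : ContinuousRep (galoisGroupAbove S (U₀ ⊓ (modNCyclotomicCharacter K (p ^ k)).ker)) ℤ
      (MuCarrier K (p ^ a)) := ContinuousRep.trivial _ ℤ _
  have hρG : ∀ (σ : (U₀ ⊓ (modNCyclotomicCharacter K (p ^ k)).ker : Subgroup (absoluteGaloisGroup K)))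
      (v : MuCarrier K (p ^ a)),
      ρG ⟨toUnramifiedQuot K S (σ : absoluteGaloisGroup K), coe_mem_galoisGroupAbove S _ σ⟩ v =
        mu K (p ^ a) (σ : absoluteGaloisGroup K) v := fun σ v ↦ by
    rw [ContinuousRep.trivial_apply, mu_eq_self_of_mem_inf_ker p U₀ hak σ.2 v]
  let f : contTwoCocycles ρG.toTopRep :=
    ⟨⟨fun q ↦ e (c.1 q), continuous_of_discreteTopology.comp c.1.continuous⟩, fun σ τ υ ↦ by
      have h := c.2 σ τ υ
      rw [ContinuousRep.toTopRep_ρ_apply, ContinuousRep.restrict_apply, subgroupIncl_apply,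
        ContinuousRep.trivial_apply] at h
      rw [ContinuousRep.toTopRep_ρ_apply, ContinuousRep.trivial_apply]
      simp only [ContinuousMap.coe_mk, ← map_add, h]⟩
  have hf : ∀ q, f.1 q = e (c.1 q) := fun _ ↦ rfl
  -- (iii) Brauer killing: a deeper stage `k₁` on which the inflated class restricts to zero
  obtain ⟨k₁, hkk₁, hT, infl, hinfl, hres⟩ :=
    exists_stage_resSub_inflation_eq_zero' p S hk2 U₀ hU₀ hk ρG hρG f hH
  -- (iv) radical descent at the OPEN stage `T = U₀ ⊓ F_{k₁}` and the `ker(inf²)` calculus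
  have hTH : U₀ ⊓ (modNCyclotomicCharacter K (p ^ k₁)).ker ≤ U₀ ⊓ (modNCyclotomicCharacter K (p ^ k)).ker :=
    inf_le_inf_left U₀ (ker_modNCyclotomicCharacter_antitone p hkk₁)
  have hTo : IsOpen ((U₀ ⊓ (modNCyclotomicCharacter K (p ^ k₁)).ker : Subgroup (absoluteGaloisGroup K)) :
      Set (absoluteGaloisGroup K)) := hU₀.inter (isOpen_ker_modNCyclotomicCharacter p k₁)
  have hNT : ramificationSubgroup K S ≤ U₀ ⊓ (modNCyclotomicCharacter K (p ^ k₁)).ker :=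
    le_inf hN (ramificationSubgroup_le_ker_modNCyclotomicCharacter p S hS k₁)
  obtain ⟨t, hRD⟩ := radicalDescent_of_isOpen K hS hTo hNT a
  obtain ⟨bμ, hbμ⟩ := exists_twoCoboundary_stage_of_resSub_inflation_eq_zero S hS hTH hT hH hNT
    (a := a) (t := t) hRD ρG hρG f infl hinfl hres
  -- (v) the way back `μ_{p^{a+t}}(K̄) → D`
  obtain ⟨g, hge⟩ := hg t
  -- (vi) the deeper stage `k' = max k₁ (a + t)`, where `μ_{p^{a+t}}` is fixed
  have hk₁k' : k₁ ≤ max k₁ (a + t) := le_max_left _ _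
  have hkk' : k ≤ max k₁ (a + t) := hkk₁.trans hk₁k'
  have hT'T : U₀ ⊓ (modNCyclotomicCharacter K (p ^ max k₁ (a + t))).ker ≤
      U₀ ⊓ (modNCyclotomicCharacter K (p ^ k₁)).ker :=
    inf_le_inf_left U₀ (ker_modNCyclotomicCharacter_antitone p hk₁k')
  have hincl : galoisGroupAbove S (U₀ ⊓ (modNCyclotomicCharacter K (p ^ max k₁ (a + t))).ker) ≤
      galoisGroupAbove S (U₀ ⊓ (modNCyclotomicCharacter K (p ^ k₁)).ker) :=
    galoisGroupAbove_inf_ker_modNCyclotomicCharacter_antitone p S U₀ hk₁k'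
  let b : C(galoisGroupAbove S (U₀ ⊓ (modNCyclotomicCharacter K (p ^ max k₁ (a + t))).ker), D) :=
    ⟨fun x ↦ g (bμ (Subgroup.inclusion hincl x)),
      continuous_of_discreteTopology.comp (bμ.continuous.comp (continuous_inclusion hincl))⟩
  have hbapp : ∀ x, b x = g (bμ (Subgroup.inclusion hincl x)) := fun _ ↦ rfl
  refine ⟨max k₁ (a + t), hkk', b, fun σ τ ↦ ?_⟩
  -- lift `σ, τ` to the stage subgroup of `Γ_K`
  obtain ⟨⟨σ₀, hσ₀⟩, rfl⟩ := galoisGroupAbove_mk_surjective S _ σ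
  obtain ⟨⟨τ₀, hτ₀⟩, rfl⟩ := galoisGroupAbove_mk_surjective S _ τ
  -- the `(B)`-identity at the pair `(σ₀, τ₀)`, read at the level `k₁`
  have hστ := hbμ ⟨σ₀, hT'T hσ₀⟩ ⟨τ₀, hT'T hτ₀⟩
  -- the action on `μ_{p^{a+t}}` is trivial at the stage `k'`
  rw [mu_eq_self_of_mem_inf_ker p U₀ (le_max_right k₁ (a + t)) hσ₀] at hστ
  -- read in `D` through `g`
  have hD := congrArg g hστ
  rw [hf, hge, map_add, map_sub] at hD
  -- identify the points
  have h1 : (c.1 (Subgroup.inclusion (galoisGroupAbove_inf_ker_modNCyclotomicCharacter_antitone p S U₀ hkk')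
        ⟨toUnramifiedQuot K S σ₀, coe_mem_galoisGroupAbove S _ ⟨σ₀, hσ₀⟩⟩,
      Subgroup.inclusion (galoisGroupAbove_inf_ker_modNCyclotomicCharacter_antitone p S U₀ hkk')
        ⟨toUnramifiedQuot K S τ₀, coe_mem_galoisGroupAbove S _ ⟨τ₀, hτ₀⟩⟩) : D) =
      (c.1 (⟨toUnramifiedQuot K S σ₀, coe_mem_galoisGroupAbove S _
          (⟨σ₀, hTH (hT'T hσ₀)⟩ : (U₀ ⊓ (modNCyclotomicCharacter K (p ^ k)).ker : Subgroup _))⟩,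
        ⟨toUnramifiedQuot K S τ₀, coe_mem_galoisGroupAbove S _
          (⟨τ₀, hTH (hT'T hτ₀)⟩ : (U₀ ⊓ (modNCyclotomicCharacter K (p ^ k)).ker : Subgroup _))⟩) : D) := rfl
  rw [h1, hD, hbapp, hbapp, hbapp]
  -- the three points of the deeper stage, included into the stage `k₁`
  have eσ : Subgroup.inclusion hincl
      (⟨toUnramifiedQuot K S σ₀, coe_mem_galoisGroupAbove S _ ⟨σ₀, hσ₀⟩⟩ :
        galoisGroupAbove S (U₀ ⊓ (modNCyclotomicCharacter K (p ^ max k₁ (a + t))).ker)) =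
      ⟨toUnramifiedQuot K S σ₀, coe_mem_galoisGroupAbove S _
        (⟨σ₀, hT'T hσ₀⟩ : (U₀ ⊓ (modNCyclotomicCharacter K (p ^ k₁)).ker : Subgroup _))⟩ := rfl
  have eτ : Subgroup.inclusion hincl
      (⟨toUnramifiedQuot K S τ₀, coe_mem_galoisGroupAbove S _ ⟨τ₀, hτ₀⟩⟩ :
        galoisGroupAbove S (U₀ ⊓ (modNCyclotomicCharacter K (p ^ max k₁ (a + t))).ker)) =
      ⟨toUnramifiedQuot K S τ₀, coe_mem_galoisGroupAbove S _
        (⟨τ₀, hT'T hτ₀⟩ : (U₀ ⊓ (modNCyclotomicCharacter K (p ^ k₁)).ker : Subgroup _))⟩ := rfl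
  have eστ : Subgroup.inclusion hincl
      ((⟨toUnramifiedQuot K S σ₀, coe_mem_galoisGroupAbove S _ ⟨σ₀, hσ₀⟩⟩ :
          galoisGroupAbove S (U₀ ⊓ (modNCyclotomicCharacter K (p ^ max k₁ (a + t))).ker)) *
        ⟨toUnramifiedQuot K S τ₀, coe_mem_galoisGroupAbove S _ ⟨τ₀, hτ₀⟩⟩) =
      ⟨toUnramifiedQuot K S ((⟨σ₀, hT'T hσ₀⟩ * ⟨τ₀, hT'T hτ₀⟩ :
          (U₀ ⊓ (modNCyclotomicCharacter K (p ^ k₁)).ker : Subgroup _)) : absoluteGaloisGroup K),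
        coe_mem_galoisGroupAbove S _ _⟩ := by
    apply Subtype.ext
    show toUnramifiedQuot K S σ₀ * toUnramifiedQuot K S τ₀ = toUnramifiedQuot K S (σ₀ * τ₀)
    rw [map_mul]
  rw [eσ, eτ, eστ]


/-! ### §2. `H²(Gal(K_Σ/K′(μ_{p^∞})), D) = 0` under the disjunction -/

/-- Every element of a group additively isomorphic to `ℚ_p/ℤ_p` is killed by a power of `p`. [folklore] -/
theorem exists_pow_nsmul_eq_zero_of_addEquiv {D : Type} [AddCommGroup D]
    (hD : Nonempty (D ≃+ ℚ_[p] ⧸ (PadicInt.subring p).toAddSubgroup)) (x : D) :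
    ∃ n : ℕ, p ^ n • x = 0 := by
  obtain ⟨e⟩ := hD
  set y : QpModZp p := (QpModZp.addEquivQuotientSubring p).symm (e x) with hy
  obtain ⟨n, hn⟩ := QpModZp.exists_pow_nsmul_eq_zero (p := p) y
  refine ⟨n, e.injective ((QpModZp.addEquivQuotientSubring p).symm.injective ?_)⟩
  rw [map_nsmul, map_nsmul, ← hy, hn, map_zero, map_zero]

/-- **`H²(Gal(K_Σ/K′(μ_{p^∞})), D) = 0` for `p ≠ 2 ∨ K` totally complex** — weak Leopoldt above the
full `p`-power cyclotomic tower of every finite `K′ = K̄^{U₀} ⊆ K_Σ` (`U₀ ≥ N_S` open), for a discrete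
`D ≃+ ℚ_p/ℤ_p` with the trivial action over any inert coefficient ring `R`: the continuous `H²` of
`galoisGroupAbove S (U₀ ⊓ ⨅ₖ ker χ̄_{p^k}) = Gal(K_Σ/K′(μ_{p^∞})) ≤ G_{K,S}` is a subsingleton.  The
tree's parity-free limit step `subsingleton_H2_above_muInfty_of_stagesDie` (Serre I §2.2 Prop. 8 in
killing form) fed with `stagesDie'`.  At `p = 2` no descent to `K′K^{cyc}_∞` is claimed (index `≤ 2`).
[cite: NeukirchSchmidtWingberg2008, (10.3.25) (proof), (10.3.22)] [cite: Iwasawa1973, §2]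
[cite: SerreGaloisCohomology1997, I §2.2 Prop. 8] -/
theorem subsingleton_H2_above_muInfty (hk2 : p ≠ 2 ∨ IsTotallyComplex K)
    (hS : ∀ v : HeightOneSpectrum (𝓞 K), ((p : ℕ) : 𝓞 K) ∈ v.asIdeal → v ∈ S)
    (U₀ : Subgroup (absoluteGaloisGroup K)) (hU₀ : IsOpen (U₀ : Set (absoluteGaloisGroup K)))
    (hN : ramificationSubgroup K S ≤ U₀)
    {R : Type} [CommRing R] [TopologicalSpace R]
    {D : Type} [AddCommGroup D] [Module R D] [TopologicalSpace D] [DiscreteTopology D]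
    [ContinuousSMul R D] (hD : Nonempty (D ≃+ ℚ_[p] ⧸ (PadicInt.subring p).toAddSubgroup)) :
    Subsingleton (continuousCohomology 2 (ContinuousRep.trivial
      (galoisGroupAbove S (U₀ ⊓ ⨅ k : ℕ, (modNCyclotomicCharacter K (p ^ k)).ker)) R D).toTopRep) :=
  subsingleton_H2_above_muInfty_of_stagesDie p S hS U₀ hU₀ hN (R := R) (D := D)
    (exists_pow_nsmul_eq_zero_of_addEquiv p hD)
    fun k a hak A _ hA c ↦ stagesDie' p S hk2 hS U₀ hU₀ hN D hD k a hak A hA c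

end Summit.BirchSwinnertonDyer.BirchSwinnertonDyer.Theorems.PrintCf2.WeakLeopoldtTwo

end
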